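import Summits.MatrixMultiplication.MatrixMultiplication.Theorems.ObstructionDescentSlotSymmetry

set_option linter.dupNamespace false

/-!
# Obstruction descent, part Z — SLOT-CHARACTER DESCENT: a character clash between consecutive formats kills the unit
# window, hence `r_N(k) > r` for `(k−1)r < kN`; `H₅ ∈ I(σ₇)` from two character values

`route-MatrixMultiplication-ObstructionDescent`, aside `InvariantSaturation` (stmt 32282); decomp-mm lens-3, NODE-g16.  The typed
form of the census's SLOT-CHARACTER WINDOW RULE H21 (I42/I45) for the UNIT WINDOW `(1 | N−1)`, built on part Y (the `S₃`
slot action `permT σ`, `rename (slotPerm σ)`), part U (the window function is the block restriction `restrictB`), gen 14 H13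
(`restrictB_mem_hwvSpace`) and the cube law of part I (`evalT_eq_zero_of_unitWindow`).

MECHANISM.  For a level-`k` vector `f` of the full format `N = m' + 1` the unit-window function
`W_f = restrictB m' e₀₀₀ f : y ↦ f(y|_{B³} + e₀₀₀)` is a level-`k` vector of the corner type `((k^{m'}))³` (H13).  The slot
action commutes with block restriction at a slot-symmetric base point (`rename_slotPerm_restrictB`, §1), so `W_f` INHERITS the
slot character of `f` (`slotChar_restrictB`): `f^σ = χ·f ⇒ W_f^σ = χ·W_f`.  If `σ` acts on the corner level space
`R_k(m') = hwvSpace (rectType (m'+1) m' k) (k m')` by a scalar `χ' ≠ χ` (e.g. `dim R_k(m') = 1`, part Y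
`exists_slotChar_level`, with the opposite sign), then `W_f = 0` (`eq_zero_of_slotChar_clash`): the unit window is DEAD
(`unitWindow_dead_of_slotChar_clash`) and the cube law fires:

* `evalT_eq_zero_of_slotChar_clash` — **SLOT-CHARACTER DESCENT LAW**: `f ∈ R_k(m'+1)`, `f^σ = χ f`, `σ|_{R_k(m')} = χ' ≠ χ`,
  `(k−1)·r < k·(m'+1)`, `R(t) ≤ r` ⇒ `f(t) = 0`; corner forms at every ambient format (`…_corner`, `…_corner'`), orbit and
  passing-level language (`hwvSpace_le_orbitVanishing_of_slotChar_clash`, `not_mem_passLevels_of_slotChar_clash`);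
* part U's descent law is the degenerate case `R_k(m') = 0` (`slotChar_of_emptyLevel`: the empty space has every character);
* §2: slot characters pass through format enlargement `liftPoly` both ways (`rename_slotPerm_liftPoly`, `slotChar_of_liftPoly`);
* §5, level `3`, format `5`: `2r < 15`, so a clash gives `H₅ ∈ I(σ₇(ℂ⁵⊗ℂ⁵⊗ℂ⁵))`, i.e. `R(t) ≤ 7 ⇒ H₅(t) = 0`
  (`evalT_eq_zero_of_level_three_five_clash`, `eight_le_tensorRank_of_level_three_five_clash`) and level `3` of block format `5`
  dead on `GL_m³·⟨m⟩`, `m ≤ 7` (`three_not_mem_passLevels_five_of_clash`) — the kernel part of `r₅(3) ≥ 8` / the dead window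
  `c₄₁(H₅) = 0`; the two remaining inputs are CHARACTER VALUES (census I42/I45, three independent codes): a transposition of
  two legs acts by `+1` on `R₃(5) = ℂ·H₅` and by `−1` on `R₃(4) = ℂ·G₄` — `S_{12}`/`S_{15}`-character facts, hypotheses here.
  (At `N = 4, 6, 9` the characters of `R₃(N)` and `R₃(N−1)` AGREE and the unit windows `c₃₁, c₅₁, c₈₁` are live: the law is
  sharp on the record.)

[cite: BurgisserIkenmeyer2011, §3.1–3.2, §6.2] (weight vectors, types, Strassen's invariant), [cite: BurgisserIkenmeyer2017,
§5 (5.2), Thm 5.3] (levels of a point), [cite: LandsbergGCT2017, §2.1, §8.3] (symmetry of tensors under permutation of factors).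
-/

noncomputable section

open scoped BigOperators
open Finset

namespace Summit.MatrixMultiplication.MatrixMultiplication.Theorems.ObstructionCalculus

open Literature.Computability.AlgebraicComplexity (actTensor triad triad_apply tensorRank unitTensor
  tensorRestrictsTo_actTensor TensorRestrictsTo)

variable {m : ℕ}

/-! ### §1 The slot action and block restriction -/

/-- Polynomial functions on tensors are determined by their values (`ℂ` is infinite). [bookkeeping] -/
theorem ext_evalT {p q : MvPolynomial (Idx m) ℂ} (h : ∀ y : Tensor ℂ m, evalT y p = evalT y q) : p = q :=
  MvPolynomial.funext fun x => by rw [eval_eq_evalT, eval_eq_evalT]; exact h _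

/-- A slot-symmetric condition on the three indices is invariant under the slot action. [bookkeeping] -/
theorem and_slot_iff (σ : Equiv.Perm (Fin 3)) (P : Fin m → Prop) (a b c : Fin m) :
    (P (slot (σ 0) (a, b, c)) ∧ P (slot (σ 1) (a, b, c)) ∧ P (slot (σ 2) (a, b, c))) ↔ (P a ∧ P b ∧ P c) := by
  have h3 : (P (slot (σ 0) (a, b, c)) ∧ P (slot (σ 1) (a, b, c)) ∧ P (slot (σ 2) (a, b, c))) ↔
      ∀ j : Fin 3, P (slot (σ j) (a, b, c)) := (forall_fin_three (P := fun j => P (slot (σ j) (a, b, c)))).symm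
  have h3' : (P a ∧ P b ∧ P c) ↔ ∀ j : Fin 3, P (slot j (a, b, c)) :=
    (forall_fin_three (P := fun j => P (slot j (a, b, c)))).symm
  rw [h3, h3']
  exact ⟨fun h j => by simpa only [Equiv.apply_symm_apply] using h (σ.symm j), fun h j => h (σ j)⟩

/-- **The slot action commutes with block mixtures** (the cube `B³` of the last block is slot-symmetric). [this node] -/
theorem permT_mixT (N₂ : ℕ) (σ : Equiv.Perm (Fin 3)) (x y : Tensor ℂ m) :
    permT σ (mixT N₂ x y) = mixT N₂ (permT σ x) (permT σ y) := by
  funext a b c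
  have key := and_slot_iff σ (fun i : Fin m => m ≤ (i : ℕ) + N₂) a b c
  rw [permT_apply]
  unfold mixT
  rw [permT_apply, permT_apply]
  by_cases h : m ≤ (a : ℕ) + N₂ ∧ m ≤ (b : ℕ) + N₂ ∧ m ≤ (c : ℕ) + N₂
  · rw [if_pos h, if_pos (key.2 h)]
  · rw [if_neg h, if_neg (mt key.1 h)]

/-- The slot action commutes with the cube projection onto the last block. [bookkeeping] -/
theorem permT_cubeLast (N₂ : ℕ) (σ : Equiv.Perm (Fin 3)) (x : Tensor ℂ m) :
    permT σ (cubeLast N₂ x) = cubeLast N₂ (permT σ x) := by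
  funext a b c
  have key := and_slot_iff σ (fun i : Fin m => m ≤ (i : ℕ) + N₂) a b c
  rw [permT_apply]
  unfold cubeLast
  rw [permT_apply]
  by_cases h : m ≤ (a : ℕ) + N₂ ∧ m ≤ (b : ℕ) + N₂ ∧ m ≤ (c : ℕ) + N₂
  · rw [if_pos h, if_pos (key.2 h)]
  · rw [if_neg h, if_neg (mt key.1 h)]

/-- **Slot action versus block restriction:** `(restrictB N₂ x f)^σ = restrictB N₂ (σ⁻¹·x) (f^σ)`. [this node] -/
theorem rename_slotPerm_restrictB (N₂ : ℕ) (σ : Equiv.Perm (Fin 3)) (x : Tensor ℂ m) (f : MvPolynomial (Idx m) ℂ) :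
    MvPolynomial.rename (slotPerm σ) (restrictB N₂ x f) =
      restrictB N₂ (permT σ⁻¹ x) (MvPolynomial.rename (slotPerm σ) f) :=
  ext_evalT fun y => by
    rw [evalT_rename_slotPerm, evalT_restrictB, evalT_restrictB, evalT_rename_slotPerm, permT_mixT, permT_permT_inv]

/-- Diagonal triads `v ⊗ v ⊗ v` (e.g. the base point `e₀₀₀` of the unit window) are slot-symmetric. [bookkeeping] -/
theorem permT_triad_diag (σ : Equiv.Perm (Fin 3)) (v : Fin m → ℂ) : permT σ (triad v v v) = triad v v v :=
  permT_triad σ fun _ => v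

/-- At a slot-symmetric base point the slot action commutes with block restriction on the nose. [this node] -/
theorem rename_slotPerm_restrictB_of_fixed (N₂ : ℕ) (σ : Equiv.Perm (Fin 3)) {x : Tensor ℂ m} (hx : permT σ x = x)
    (f : MvPolynomial (Idx m) ℂ) :
    MvPolynomial.rename (slotPerm σ) (restrictB N₂ x f) = restrictB N₂ x (MvPolynomial.rename (slotPerm σ) f) := by
  have hx' : permT σ⁻¹ x = x :=
    calc permT σ⁻¹ x = permT σ⁻¹ (permT σ x) := by rw [hx]
      _ = x := permT_inv_permT σ x
  rw [rename_slotPerm_restrictB, hx']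

/-- **The window function inherits the slot character:** `f^σ = χ f ⇒ (restrictB N₂ x f)^σ = χ · restrictB N₂ x f` at a
slot-symmetric base point `x`. [this node] -/
theorem slotChar_restrictB (N₂ : ℕ) (σ : Equiv.Perm (Fin 3)) {x : Tensor ℂ m} (hx : permT σ x = x)
    {f : MvPolynomial (Idx m) ℂ} {χ : ℂ} (hf : MvPolynomial.rename (slotPerm σ) f = χ • f) :
    MvPolynomial.rename (slotPerm σ) (restrictB N₂ x f) = χ • restrictB N₂ x f := by
  rw [rename_slotPerm_restrictB_of_fixed N₂ σ hx, hf, map_smul]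

/-! ### §2 Slot characters and format enlargement -/

section Lift

variable {d : ℕ}

/-- Slots of a lifted index triple. [bookkeeping] -/
theorem slot_liftI (d : ℕ) (j : Fin 3) (p : Idx m) : slot j (liftI d p) = Fin.natAdd d (slot j p) := by
  fin_cases j <;> rfl

/-- The corner embedding commutes with slot permutations. [bookkeeping] -/
theorem liftI_slotPerm (d : ℕ) (σ : Equiv.Perm (Fin 3)) (p : Idx m) :
    liftI d (slotPerm σ p) = slotPerm σ (liftI d p) :=
  ext_slot fun j => by simp only [slot_liftI, slot_slotPerm]

/-- **Format enlargement commutes with the slot action:** `(liftPoly d f)^σ = liftPoly d (f^σ)`. [this node] -/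
theorem rename_slotPerm_liftPoly (d : ℕ) (σ : Equiv.Perm (Fin 3)) (f : MvPolynomial (Idx m) ℂ) :
    MvPolynomial.rename (slotPerm σ) (liftPoly d f) = liftPoly d (MvPolynomial.rename (slotPerm σ) f) := by
  unfold liftPoly
  rw [MvPolynomial.rename_rename, MvPolynomial.rename_rename]
  exact congrArg (fun e : Idx m → Idx (d + m) => MvPolynomial.rename e f)
    (funext fun p => (liftI_slotPerm d σ p).symm)

/-- Slot characters ascend along format enlargement. [this node] -/
theorem slotChar_liftPoly (d : ℕ) (σ : Equiv.Perm (Fin 3)) {f : MvPolynomial (Idx m) ℂ} {c : ℂ}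
    (h : MvPolynomial.rename (slotPerm σ) f = c • f) : MvPolynomial.rename (slotPerm σ) (liftPoly d f) = c • liftPoly d f := by
  rw [rename_slotPerm_liftPoly, h]
  unfold liftPoly
  rw [map_smul]

/-- … and DESCEND: a lifted polynomial with a slot character has it already downstairs (`liftPoly` is injective). [this node] -/
theorem slotChar_of_liftPoly (σ : Equiv.Perm (Fin 3)) {f : MvPolynomial (Idx m) ℂ} {c : ℂ}
    (h : MvPolynomial.rename (slotPerm σ) (liftPoly d f) = c • liftPoly d f) : MvPolynomial.rename (slotPerm σ) f = c • f := by
  rw [rename_slotPerm_liftPoly] at h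
  have hinj : Function.Injective (MvPolynomial.rename (R := ℂ) (liftI (m := m) d)) :=
    MvPolynomial.rename_injective _ (liftI_injective d)
  apply hinj
  show liftPoly d (MvPolynomial.rename (slotPerm σ) f) = liftPoly d (c • f)
  rw [h]
  unfold liftPoly
  rw [map_smul]

end Lift

/-! ### §3 Character clash -/

/-- **Character clash.**  If `σ` acts on a space `V` by the scalar `χ'` and `W ∈ V` is a `σ`-eigenvector of a DIFFERENT
character `χ`, then `W = 0`. [this node] -/
theorem eq_zero_of_slotChar_clash (σ : Equiv.Perm (Fin 3)) {V : Submodule ℂ (MvPolynomial (Idx m) ℂ)} {χ χ' : ℂ}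
    (hV : ∀ G ∈ V, MvPolynomial.rename (slotPerm σ) G = χ' • G) (hne : χ ≠ χ') {W : MvPolynomial (Idx m) ℂ} (hW : W ∈ V)
    (hWχ : MvPolynomial.rename (slotPerm σ) W = χ • W) : W = 0 := by
  have h := hV W hW
  rw [hWχ] at h
  have h2 : (χ - χ') • W = 0 := by rw [sub_smul, h, sub_self]
  exact (smul_eq_zero.1 h2).resolve_left (sub_ne_zero.2 hne)

/-- The degenerate case (part U): an EMPTY corner level space carries every character. [bookkeeping] -/
theorem slotChar_of_emptyLevel {m' k : ℕ} (hk : k ∈ emptyLevels m' m') (σ : Equiv.Perm (Fin 3)) (χ' : ℂ) :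
    ∀ G ∈ hwvSpace (rectType (m' + 1) m' k) (k * m'), MvPolynomial.rename (slotPerm σ) G = χ' • G := by
  intro G hG
  have hbot : hwvSpace (rectType (m' + 1) m' k) (k * m') = ⊥ := (mem_emptyLevels_iff_self (Nat.le_succ m')).mpr hk
  rw [hbot, Submodule.mem_bot] at hG
  rw [hG, map_zero, smul_zero]

/-- **A `σ`-stable line carries a UNIFORM slot character** (the hypothesis shape of §4 from `dim ≤ 1`, part Y). [this node] -/
theorem exists_uniform_slotChar_of_dim_le_one (σ : Equiv.Perm (Fin 3)) {V : Submodule ℂ (MvPolynomial (Idx m) ℂ)}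
    {f₀ : MvPolynomial (Idx m) ℂ} (hf₀ : f₀ ∈ V) (hV : ∀ g ∈ V, ∃ c : ℂ, g = c • f₀)
    (hstab : ∀ g ∈ V, MvPolynomial.rename (slotPerm σ) g ∈ V) :
    ∃ χ : ℂ, ∀ G ∈ V, MvPolynomial.rename (slotPerm σ) G = χ • G := by
  obtain ⟨χ, hχ⟩ := exists_slotChar_of_dim_le_one σ hV hstab hf₀
  refine ⟨χ, fun G hG => ?_⟩
  obtain ⟨c, rfl⟩ := hV G hG
  rw [map_smul, hχ, smul_comm]

/-- Level spaces: a one-dimensional level space `ℂ·f₀` has a uniform slot character under every `σ ∈ S₃`. [this node] -/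
theorem exists_uniform_slotChar_level {N k : ℕ} (σ : Equiv.Perm (Fin 3)) {f₀ : MvPolynomial (Idx m) ℂ}
    (hf₀ : f₀ ∈ hwvSpace (rectType m N k) (k * N)) (hV : ∀ g ∈ hwvSpace (rectType m N k) (k * N), ∃ c : ℂ, g = c • f₀) :
    ∃ χ : ℂ, ∀ G ∈ hwvSpace (rectType m N k) (k * N), MvPolynomial.rename (slotPerm σ) G = χ • G :=
  exists_uniform_slotChar_of_dim_le_one σ hf₀ hV fun _ hg => rename_slotPerm_mem_level hg σ

/-- **Characters pass from the self format to the corner:** if `σ` acts by `χ'` on `R_k(m)` in its own format `m`, it acts by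
`χ'` on the corner realisation of `R_k(m)` in every larger format `d + m`. [this node] -/
theorem slotChar_corner_of_self (d : ℕ) {k : ℕ} (σ : Equiv.Perm (Fin 3)) {χ' : ℂ}
    (hV : ∀ g ∈ hwvSpace (rectType m m k) (k * m), MvPolynomial.rename (slotPerm σ) g = χ' • g) :
    ∀ G ∈ hwvSpace (rectType (d + m) m k) (k * m), MvPolynomial.rename (slotPerm σ) G = χ' • G := by
  intro G hG
  obtain ⟨g, hg, rfl⟩ := exists_eq_liftPoly_of_mem_hwvSpace le_rfl hG
  exact slotChar_liftPoly d σ (hV g hg)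

/-! ### §4 The slot-character descent law -/

section Descent

variable {m' : ℕ}

/-- **A character clash between the formats `m' + 1` and `m'` kills the unit window.**  If `σ` acts on the corner level
space `hwvSpace (rectType (m'+1) m' k) (k m')` by `χ'` and `f ∈ R_k(m'+1)` has `f^σ = χ f` with `χ ≠ χ'`, then
`f(y⁰ + e₀₀₀) = 0` for every `y⁰` off the slices through `0`. [this node] -/
theorem unitWindow_dead_of_slotChar_clash {k : ℕ} (σ : Equiv.Perm (Fin 3)) {χ χ' : ℂ} (hne : χ ≠ χ')
    (hV : ∀ G ∈ hwvSpace (rectType (m' + 1) m' k) (k * m'), MvPolynomial.rename (slotPerm σ) G = χ' • G)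
    {f : MvPolynomial (Idx (m' + 1)) ℂ} (hf : f ∈ hwvSpace (rectType (m' + 1) (m' + 1) k) (k * (m' + 1)))
    (hfχ : MvPolynomial.rename (slotPerm σ) f = χ • f) (y : Tensor ℂ (m' + 1)) :
    evalT ((fun a b c => if a = 0 ∨ b = 0 ∨ c = 0 then 0 else y a b c) +
      triad (Pi.single (0 : Fin (m' + 1)) (1 : ℂ)) (Pi.single 0 1) (Pi.single 0 1)) f = 0 := by
  have hW : restrictB m' (triad (Pi.single (0 : Fin (m' + 1)) (1 : ℂ)) (Pi.single 0 1) (Pi.single 0 1)) f ∈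
      hwvSpace (rectType (m' + 1) m' k) (k * m') :=
    restrictB_mem_hwvSpace (Nat.le_succ m') (Nat.le_succ m') (triad_single_zero_mem_blockDiag m') hf
  have he : permT σ (triad (Pi.single (0 : Fin (m' + 1)) (1 : ℂ)) (Pi.single 0 1) (Pi.single 0 1)) =
      triad (Pi.single (0 : Fin (m' + 1)) (1 : ℂ)) (Pi.single 0 1) (Pi.single 0 1) := permT_triad_diag σ _
  have hW0 := eq_zero_of_slotChar_clash σ hV hne hW (slotChar_restrictB m' σ he hfχ)
  rw [← mixT_triad_single_zero, ← evalT_restrictB, hW0, map_zero]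

/-- **SLOT-CHARACTER DESCENT LAW.**  Under a character clash between `R_k(m'+1) ∋ f` (`f^σ = χ f`) and the corner level space
`R_k(m')` (on which `σ` acts by `χ' ≠ χ`), `f` vanishes on all tensors of rank `≤ r` with `(k−1)·r < k·(m'+1)`. [this node] -/
theorem evalT_eq_zero_of_slotChar_clash {k : ℕ} (σ : Equiv.Perm (Fin 3)) {χ χ' : ℂ} (hne : χ ≠ χ')
    (hV : ∀ G ∈ hwvSpace (rectType (m' + 1) m' k) (k * m'), MvPolynomial.rename (slotPerm σ) G = χ' • G)
    {f : MvPolynomial (Idx (m' + 1)) ℂ} (hf : f ∈ hwvSpace (rectType (m' + 1) (m' + 1) k) (k * (m' + 1)))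
    (hfχ : MvPolynomial.rename (slotPerm σ) f = χ • f) {r : ℕ} (hr : (k - 1) * r < k * (m' + 1))
    {t : Tensor ℂ (m' + 1)} (ht : tensorRank t ≤ r) : evalT t f = 0 :=
  evalT_eq_zero_of_unitWindow hf (a := 0) (b := 0) (c := 0)
    (fun y => unitWindow_dead_of_slotChar_clash σ hne hV hf hfχ y) hr ht

/-- **Corner form, single vector:** at every ambient format `m ≥ m' + 1`, for a corner-type level vector `F` with its own
slot character `χ`. [this node] -/
theorem evalT_eq_zero_of_slotChar_clash_corner {m k : ℕ} (hNm : m' + 1 ≤ m) (σ : Equiv.Perm (Fin 3)) {χ χ' : ℂ}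
    (hne : χ ≠ χ')
    (hV : ∀ G ∈ hwvSpace (rectType (m' + 1) m' k) (k * m'), MvPolynomial.rename (slotPerm σ) G = χ' • G)
    {F : MvPolynomial (Idx m) ℂ} (hF : F ∈ hwvSpace (rectType m (m' + 1) k) (k * (m' + 1)))
    (hFχ : MvPolynomial.rename (slotPerm σ) F = χ • F) {r : ℕ} (hr : (k - 1) * r < k * (m' + 1)) {t : Tensor ℂ m}
    (ht : tensorRank t ≤ r) : evalT t F = 0 := by
  obtain ⟨d, rfl⟩ : ∃ d, m = d + (m' + 1) := ⟨m - (m' + 1), by omega⟩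
  obtain ⟨f, hf, rfl⟩ := exists_eq_liftPoly_of_mem_hwvSpace le_rfl hF
  rw [evalT_liftPoly]
  exact evalT_eq_zero_of_slotChar_clash σ hne hV hf (slotChar_of_liftPoly σ hFχ) hr
    ((tensorRank_cornerOf_le d t).trans ht)

/-- **Corner form, whole level:** if `σ` acts by `χ` on `R_k(m'+1)` and by `χ' ≠ χ` on `R_k(m')`, every corner-type level-`k`
vector of block format `m' + 1` at any ambient format vanishes on rank `≤ r`, `(k−1)r < k(m'+1)`. [this node] -/
theorem evalT_eq_zero_of_slotChar_clash_corner' {m k : ℕ} (hNm : m' + 1 ≤ m) (σ : Equiv.Perm (Fin 3)) {χ χ' : ℂ}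
    (hne : χ ≠ χ')
    (hV : ∀ G ∈ hwvSpace (rectType (m' + 1) m' k) (k * m'), MvPolynomial.rename (slotPerm σ) G = χ' • G)
    (hU : ∀ g ∈ hwvSpace (rectType (m' + 1) (m' + 1) k) (k * (m' + 1)), MvPolynomial.rename (slotPerm σ) g = χ • g)
    {F : MvPolynomial (Idx m) ℂ} (hF : F ∈ hwvSpace (rectType m (m' + 1) k) (k * (m' + 1)))
    {r : ℕ} (hr : (k - 1) * r < k * (m' + 1)) {t : Tensor ℂ m} (ht : tensorRank t ≤ r) : evalT t F = 0 := by
  obtain ⟨d, rfl⟩ : ∃ d, m = d + (m' + 1) := ⟨m - (m' + 1), by omega⟩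
  obtain ⟨f, hf, rfl⟩ := exists_eq_liftPoly_of_mem_hwvSpace le_rfl hF
  rw [evalT_liftPoly]
  exact evalT_eq_zero_of_slotChar_clash σ hne hV hf (hU f hf) hr ((tensorRank_cornerOf_le d t).trans ht)

/-- Point-level language: under a clash, level `k` is not a level of any point of rank `≤ r`, `(k−1)r < k(m'+1)`. [this node] -/
theorem not_mem_pointLevels_of_slotChar_clash {m k : ℕ} (hNm : m' + 1 ≤ m) (σ : Equiv.Perm (Fin 3)) {χ χ' : ℂ}
    (hne : χ ≠ χ')
    (hV : ∀ G ∈ hwvSpace (rectType (m' + 1) m' k) (k * m'), MvPolynomial.rename (slotPerm σ) G = χ' • G)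
    (hU : ∀ g ∈ hwvSpace (rectType (m' + 1) (m' + 1) k) (k * (m' + 1)), MvPolynomial.rename (slotPerm σ) g = χ • g)
    {r : ℕ} (hr : (k - 1) * r < k * (m' + 1)) {t : Tensor ℂ m} (ht : tensorRank t ≤ r) :
    k ∉ pointLevels (m' + 1) t := by
  rintro ⟨F, hF, hne0⟩
  exact hne0 (evalT_eq_zero_of_slotChar_clash_corner' hNm σ hne hV hU hF hr ht)

/-- Orbit language: under a clash, level `k` of block format `m' + 1` lies in the ideal of `GL_m³·u` for every `u` of rank
`≤ r`, `(k−1)r < k(m'+1)`. [this node] -/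
theorem hwvSpace_le_orbitVanishing_of_slotChar_clash {m k : ℕ} (hNm : m' + 1 ≤ m) (σ : Equiv.Perm (Fin 3)) {χ χ' : ℂ}
    (hne : χ ≠ χ')
    (hV : ∀ G ∈ hwvSpace (rectType (m' + 1) m' k) (k * m'), MvPolynomial.rename (slotPerm σ) G = χ' • G)
    (hU : ∀ g ∈ hwvSpace (rectType (m' + 1) (m' + 1) k) (k * (m' + 1)), MvPolynomial.rename (slotPerm σ) g = χ • g)
    {r : ℕ} (hr : (k - 1) * r < k * (m' + 1)) {u : Tensor ℂ m} (hu : tensorRank u ≤ r) :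
    hwvSpace (rectType m (m' + 1) k) (k * (m' + 1)) ≤ orbitVanishing u := by
  intro F hF A B C _ _ _
  exact evalT_eq_zero_of_slotChar_clash_corner' hNm σ hne hV hU hF hr
    ((tensorRestrictsTo_actTensor A B C u).tensorRank_le.trans hu)

/-- Passing-level language: under a clash, level `k` of block format `m' + 1` does not pass at any ambient format `m` with
`m' + 1 ≤ m` and `(k−1)·m < k·(m'+1)`. [this node] -/
theorem not_mem_passLevels_of_slotChar_clash {m k : ℕ} (hNm : m' + 1 ≤ m) (hm : (k - 1) * m < k * (m' + 1))
    (σ : Equiv.Perm (Fin 3)) {χ χ' : ℂ} (hne : χ ≠ χ')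
    (hV : ∀ G ∈ hwvSpace (rectType (m' + 1) m' k) (k * m'), MvPolynomial.rename (slotPerm σ) G = χ' • G)
    (hU : ∀ g ∈ hwvSpace (rectType (m' + 1) (m' + 1) k) (k * (m' + 1)), MvPolynomial.rename (slotPerm σ) g = χ • g) :
    k ∉ passLevels m (m' + 1) := fun h =>
  h (hwvSpace_le_orbitVanishing_of_slotChar_clash hNm σ hne hV hU hm (tensorRank_unitTensor_le' m))

/-- The degenerate clash: with an EMPTY corner level the law is part U's descent law (any `f`, character or not, is covered by
part U; here the character form for comparison). [bookkeeping] -/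
theorem evalT_eq_zero_of_slotChar_emptyLevel {k : ℕ} (hk : k ∈ emptyLevels m' m') (σ : Equiv.Perm (Fin 3)) {χ : ℂ}
    {f : MvPolynomial (Idx (m' + 1)) ℂ} (hf : f ∈ hwvSpace (rectType (m' + 1) (m' + 1) k) (k * (m' + 1)))
    (hfχ : MvPolynomial.rename (slotPerm σ) f = χ • f) {r : ℕ} (hr : (k - 1) * r < k * (m' + 1))
    {t : Tensor ℂ (m' + 1)} (ht : tensorRank t ≤ r) : evalT t f = 0 :=
  evalT_eq_zero_of_slotChar_clash σ (χ' := χ + 1) (by simp) (slotChar_of_emptyLevel hk σ (χ + 1)) hf hfχ hr ht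

end Descent

/-! ### §5 Level `3`, format `5`: `H₅ ∈ I(σ₇)` from two character values -/

section LevelThreeFive

/-- **`H₅ ∈ I(σ₇)` from the slot-character clash.**  If a slot permutation `σ` acts on the corner space `R₃(4)` (type
`((3⁴))³` in format `5`; classically `ℂ·G₄`) by `χ'` and a level-`3` vector `f` of format `5` (classically `H₅`) has
`f^σ = χ f` with `χ ≠ χ'` (census: `χ = +1`, `χ' = −1` for a transposition), then `f(t) = 0` whenever `R(t) ≤ 7`. [this node] -/
theorem evalT_eq_zero_of_level_three_five_clash (σ : Equiv.Perm (Fin 3)) {χ χ' : ℂ} (hne : χ ≠ χ')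
    (hV : ∀ G ∈ hwvSpace (rectType 5 4 3) (3 * 4), MvPolynomial.rename (slotPerm σ) G = χ' • G)
    {f : MvPolynomial (Idx 5) ℂ} (hf : f ∈ hwvSpace (rectType 5 5 3) (3 * 5))
    (hfχ : MvPolynomial.rename (slotPerm σ) f = χ • f) {t : Tensor ℂ 5} (ht : tensorRank t ≤ 7) : evalT t f = 0 :=
  evalT_eq_zero_of_slotChar_clash (m' := 4) σ hne hV hf hfχ (r := 7) (by norm_num) ht

/-- … equivalently `f(t) ≠ 0 ⇒ R(t) ≥ 8`. [this node] -/
theorem eight_le_tensorRank_of_level_three_five_clash (σ : Equiv.Perm (Fin 3)) {χ χ' : ℂ} (hne : χ ≠ χ')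
    (hV : ∀ G ∈ hwvSpace (rectType 5 4 3) (3 * 4), MvPolynomial.rename (slotPerm σ) G = χ' • G)
    {f : MvPolynomial (Idx 5) ℂ} (hf : f ∈ hwvSpace (rectType 5 5 3) (3 * 5))
    (hfχ : MvPolynomial.rename (slotPerm σ) f = χ • f) {t : Tensor ℂ 5} (hne0 : evalT t f ≠ 0) : 8 ≤ tensorRank t := by
  by_contra hlt
  exact hne0 (evalT_eq_zero_of_level_three_five_clash σ hne hV hf hfχ (by omega))

/-- **Level `3` of block format `5` is dead on `GL_m³·⟨m⟩` for `5 ≤ m ≤ 7`** under the clash (`σ` acts by `χ` on `R₃(5)`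
and by `χ' ≠ χ` on `R₃(4)`): `3 ∉ passLevels m 5`. [this node] -/
theorem three_not_mem_passLevels_five_of_clash {m : ℕ} (hNm : 5 ≤ m) (hm : m ≤ 7) (σ : Equiv.Perm (Fin 3)) {χ χ' : ℂ}
    (hne : χ ≠ χ') (hV : ∀ G ∈ hwvSpace (rectType 5 4 3) (3 * 4), MvPolynomial.rename (slotPerm σ) G = χ' • G)
    (hU : ∀ g ∈ hwvSpace (rectType 5 5 3) (3 * 5), MvPolynomial.rename (slotPerm σ) g = χ • g) :
    3 ∉ passLevels m 5 :=
  not_mem_passLevels_of_slotChar_clash (m' := 4) hNm (by omega) σ hne hV hU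

/-- The same with the corner character read off in FORMAT `4` ITSELF (`R₃(4) = hwvSpace (rectType 4 4 3) 12`, classically
`ℂ·G₄`): the inputs are then literally «`σ` acts by `χ` on `R₃(5)` and by `χ' ≠ χ` on `R₃(4)`». [this node] -/
theorem three_not_mem_passLevels_five_of_clash' {m : ℕ} (hNm : 5 ≤ m) (hm : m ≤ 7) (σ : Equiv.Perm (Fin 3)) {χ χ' : ℂ}
    (hne : χ ≠ χ') (hV : ∀ g ∈ hwvSpace (rectType 4 4 3) (3 * 4), MvPolynomial.rename (slotPerm σ) g = χ' • g)
    (hU : ∀ g ∈ hwvSpace (rectType 5 5 3) (3 * 5), MvPolynomial.rename (slotPerm σ) g = χ • g) :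
    3 ∉ passLevels m 5 :=
  three_not_mem_passLevels_five_of_clash hNm hm σ hne (slotChar_corner_of_self 1 σ hV) hU

/-- … and the rank form: `f ∈ R₃(5)`, `f^σ = χ f`, `σ|_{R₃(4)} = χ' ≠ χ` (format `4` itself), `f(t) ≠ 0 ⇒ R(t) ≥ 8`. [this node] -/
theorem eight_le_tensorRank_of_level_three_five_clash' (σ : Equiv.Perm (Fin 3)) {χ χ' : ℂ} (hne : χ ≠ χ')
    (hV : ∀ g ∈ hwvSpace (rectType 4 4 3) (3 * 4), MvPolynomial.rename (slotPerm σ) g = χ' • g)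
    {f : MvPolynomial (Idx 5) ℂ} (hf : f ∈ hwvSpace (rectType 5 5 3) (3 * 5))
    (hfχ : MvPolynomial.rename (slotPerm σ) f = χ • f) {t : Tensor ℂ 5} (hne0 : evalT t f ≠ 0) : 8 ≤ tensorRank t :=
  eight_le_tensorRank_of_level_three_five_clash σ hne (slotChar_corner_of_self 1 σ hV) hf hfχ hne0

end LevelThreeFive

end Summit.MatrixMultiplication.MatrixMultiplication.Theorems.ObstructionCalculus
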